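import Mathlib
import HarnessLib
import Summits.HubbardSuperconductivity.HubbardSuperconductivity.Theorems.KLProgrammeKLRegimeSplitFlowPieceOscDefs
import Summits.HubbardSuperconductivity.HubbardSuperconductivity.Theorems.KLProgrammeKLRegimeSplitCounterMap
import Summits.HubbardSuperconductivity.HubbardSuperconductivity.Theorems.KLProgrammeKLRegimeSplitFrameLemmas

/-!
# Route `KLProgramme`, crux K3 — gen-8 ENGINE-FLOW child (stmt-HubbardSuperconductivity-20437 `KLRegimeEngineV17F2`), v2 token #19 (K5′) ((R59ax)/(R59bg)):
# the MEAN-FREE flow pieces as ADMISSIBLE FRAME PIECES in `U²` currency, and the MEAN-FREE FLOW FRAME as a level-shifted frame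
# (what the (c-D) telescoping / the (b) tower instantiate; cell gate-hubbard-kl, seat hubbard-kl-r2d-p1 g9)

`FlowPieceOscAt L M c″ β U μ m` (…SplitFlowPieceOscDefs, p568737) books the mean-free part `r_m := evalM (klFlowPiece m) − klAngularMean ν_m` of the scale-`m`
flow piece at `c″·U²·4^{−2m}`; the registered `FlowPieceJetsAt … R m` books the piece's derivatives of orders `1 ≤ j ≤ 4` at `R.Gfr j·U²·4^{(j−2)m}`, and
constants have no derivatives.  So:

* §1 **`FlowPieceOscAt.pieceClause`** — `r_m` satisfies the `FrameOK` PIECE CLAUSE `‖Dʲ r_m‖ ≤ G j·uPow j U·4^{(j−2)m}` (`j ≤ 4`) with the table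
  `G := (c″·|U|, R.Gfr 1, R.Gfr 2, R.Gfr 3, R.Gfr 4)` — i.e. an admissible frame piece whose ORDER-0 constant is `c″·|U|` (so `G 0·uPow 0 U = c″·U²`: the
  `U²` currency E1 WORD10 (W3) / CD-LIMITS §0 line 4 ask for), orders `≥ 1` VERBATIM the registered jets (`iteratedFDeriv_evalM_klFlowPiece_sub_const`);
* §2 **the mean-free flow frame** `K̊_n := K_n ⊖ s_n` with `s_n := −Σ_{m<n} klAngularMean ν_m` (the constant frame `symInterp L (fun _ => s_n)`):
  `eval_klFlowFrameU_oscPart` (`K̊_n = −Σ_{m<n} r_m` pointwise), **`frameLevel_klFlowFrameU_eq_shift`** (`e_{K_n}` at level `μ` IS `e_{K̊_n}` at level `μ + s_n` —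
  k3c3-p1's `frameLevel_of_eval_eq_add_const`), `abs_evalM_klFlowFrameU_oscPart_le` (`|K̊_n| ≤ (16/15)·c″·U²` under the piece clauses at `m < n`), and the
  derivatives of `K̊_n` = those of `K_n` (`iteratedFDeriv_evalM_klFlowFrameU_oscPart`).

Proofs only; no definitions; nothing about the Hubbard model is asserted (implications from the named clauses); nothing here asserts any stub of 20437, K3 or
superconductivity.  References: BGM 2006 §2.4 (2.36) [cite: BenfattoGiulianiMastropietro2006]; BGM 2003 §2 (δμ = chemical-potential renormalisation).
-/

noncomputable section

namespace Summit.HubbardSuperconductivity.HubbardSuperconductivity.Theorems.KLRegimeSplit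

set_option linter.dupNamespace false -- summit = problem name (single-conjunct summit), D-0017

open Real Finset Literature.MathematicalPhysics.QuantumLattice Literature.Probability.LatticeModels
open Literature.MathematicalPhysics.QuantumLattice.FermiRG
open Summit.HubbardSuperconductivity.HubbardSuperconductivity.Theorems.DispersionFlow

section Model

variable {L M : ℕ} [NeZero L] [NeZero M]

/-! ## §1 The mean-free piece is an admissible frame piece with order-0 constant `c″·|U|` -/

/-- Subtracting a constant does not change the derivatives of order `j ≠ 0` of `evalM A`. -/
theorem iteratedFDeriv_evalM_sub_const (A : TrigPolyC4v) (c : ℝ) {j : ℕ} (hj : j ≠ 0) (q : Momentum) :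
    iteratedFDeriv ℝ j (fun q => evalM A q - c) q = iteratedFDeriv ℝ j (evalM A) q := by
  have h := iteratedFDeriv_sub_apply (𝕜 := ℝ) (i := j) (f := evalM A) (g := fun _ : Momentum => c) (x := q)
    ((contDiff_evalM A).contDiffAt) contDiffAt_const
  rw [show (evalM A - fun _ : Momentum => c) = fun q => evalM A q - c from rfl] at h
  rw [h, iteratedFDeriv_const_of_ne hj, Pi.zero_apply, sub_zero]

/-- **Order 0 of the mean-free piece in `FrameOK`'s `uPow` form**: `FlowPieceOscAt … c″ … m` gives `‖D⁰ r_m‖ ≤ (c″·|U|)·uPow 0 U·4^{((0:ℤ)−2)·m}`. -/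
theorem FlowPieceOscAt.norm_iteratedFDeriv_zero_le {c'' β U μ : ℝ} {m : ℕ} (h : FlowPieceOscAt L M c'' β U μ m) (q : Momentum) :
    ‖iteratedFDeriv ℝ 0 (fun q => evalM (klFlowPiece L M β U μ m) q -
        klAngularMean (klLocalPart L M β U μ (klFlowFrameU L M β U μ m) m)) q‖ ≤
      c'' * |U| * uPow 0 U * (4 : ℝ) ^ ((((0 : ℕ) : ℤ) - 2) * (m : ℤ)) := by
  rw [norm_iteratedFDeriv_zero, Real.norm_eq_abs, four_zpow_ord_zero_eq]
  have hu : uPow 0 U = |U| := by simp [uPow]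
  rw [hu, show c'' * |U| * |U| = c'' * U ^ 2 by rw [mul_assoc, ← sq_abs, ← pow_two]]
  exact h q

/-- **THE PIECE CLAUSE OF THE MEAN-FREE PIECE** ((K5′) in `FrameOK` currency): under `FlowPieceOscAt … c″ … m` and the registered `FlowPieceJetsAt … R m`, for
every `j ≤ 4` and `q`, `‖Dʲ r_m (q)‖ ≤ G j·uPow j U·4^{(j−2)m}` with `G 0 = c″·|U|`, `G j = R.Gfr j` (`j ≥ 1`) — an admissible frame piece in `U²` currency at
order 0. -/
theorem FlowPieceOscAt.pieceClause {c'' β U μ : ℝ} {m : ℕ} {R : RenConsts} (h : FlowPieceOscAt L M c'' β U μ m)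
    (hJ : FlowPieceJetsAt L M β U μ R m) {j : ℕ} (hj : j ≤ 4) (q : Momentum) :
    ‖iteratedFDeriv ℝ j (fun q => evalM (klFlowPiece L M β U μ m) q -
        klAngularMean (klLocalPart L M β U μ (klFlowFrameU L M β U μ m) m)) q‖ ≤
      (if j = 0 then c'' * |U| else R.Gfr j) * uPow j U * (4 : ℝ) ^ (((j : ℤ) - 2) * (m : ℤ)) := by
  rcases Nat.eq_zero_or_pos j with rfl | hj0
  · simpa using h.norm_iteratedFDeriv_zero_le q
  · rw [if_neg hj0.ne', iteratedFDeriv_evalM_sub_const _ _ hj0.ne']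
    exact hJ j hj q

/-- The piece clause with a UNIFORM table: if `c″·|U| ≤ R.Gfr 0` (e.g. `U ≤ R.Gfr 0/c″`) the mean-free piece satisfies `FlowPieceJetsAt`'s own bound at every
order — so it is at least as admissible as the piece itself. -/
theorem FlowPieceOscAt.pieceClause_Gfr {c'' β U μ : ℝ} {m : ℕ} {R : RenConsts} (h : FlowPieceOscAt L M c'' β U μ m)
    (hJ : FlowPieceJetsAt L M β U μ R m) (hfit : c'' * |U| ≤ R.Gfr 0) {j : ℕ} (hj : j ≤ 4) (q : Momentum) :
    ‖iteratedFDeriv ℝ j (fun q => evalM (klFlowPiece L M β U μ m) q -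
        klAngularMean (klLocalPart L M β U μ (klFlowFrameU L M β U μ m) m)) q‖ ≤
      R.Gfr j * uPow j U * (4 : ℝ) ^ (((j : ℤ) - 2) * (m : ℤ)) := by
  refine (h.pieceClause hJ hj q).trans (mul_le_mul_of_nonneg_right (mul_le_mul_of_nonneg_right ?_ (uPow_nonneg' j U))
    (zpow_nonneg (by norm_num) _))
  split_ifs with hj0
  · subst hj0; exact hfit
  · exact le_rfl

/-! ## §2 The mean-free flow frame `K̊_n = K_n ⊖ s_n` and the level shift -/

/-- The constant frame subtracted: `(K ⊖ c)(p) = K(p) − c`. -/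
theorem eval_fsub_symInterp_const (K : TrigPolyC4v) (c : ℝ) (p : Fin 2 → ℝ) :
    (fsub K (symInterp L fun _ => c)).eval p = K.eval p - c := by
  rw [eval_fsub, eval_symInterp_const]

/-- **The flow frame is its mean-free part plus the δμ constant** `s_n := −Σ_{m<n} klAngularMean ν_m`:
`K_n(p) = (K_n ⊖ s_n)(p) + s_n`. -/
theorem eval_klFlowFrameU_eq_oscPart_add (β U μ : ℝ) (n : ℕ) (p : Fin 2 → ℝ) :
    (klFlowFrameU L M β U μ n).eval p =
      (fsub (klFlowFrameU L M β U μ n) (symInterp L fun _ =>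
          -(∑ m ∈ range n, klAngularMean (klLocalPart L M β U μ (klFlowFrameU L M β U μ m) m)))).eval p +
        -(∑ m ∈ range n, klAngularMean (klLocalPart L M β U μ (klFlowFrameU L M β U μ m) m)) := by
  rw [eval_fsub_symInterp_const]; ring

/-- **The mean-free flow frame is minus the sum of the mean-free pieces**: `(K_n ⊖ s_n)(p) = −Σ_{m<n} (klFlowPiece m (p) − klAngularMean ν_m)`. -/
theorem eval_klFlowFrameU_oscPart (β U μ : ℝ) (n : ℕ) (p : Fin 2 → ℝ) :
    (fsub (klFlowFrameU L M β U μ n) (symInterp L fun _ =>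
        -(∑ m ∈ range n, klAngularMean (klLocalPart L M β U μ (klFlowFrameU L M β U μ m) m)))).eval p =
      -∑ m ∈ range n, ((klFlowPiece L M β U μ m).eval p -
        klAngularMean (klLocalPart L M β U μ (klFlowFrameU L M β U μ m) m)) := by
  rw [eval_fsub_symInterp_const, eval_klFlowFrameU_eq_neg_sum_mean_sub]
  ring

/-- **THE LEVEL SHIFT** (E1 (Q-E1′) = YES): the band of the flow frame at level `μ` IS the band of its mean-free part at level `μ + s_n`:
`frameLevel μ K_n = frameLevel (μ + s_n) (K_n ⊖ s_n)` — the δμ constants of the pieces are a chemical-potential renormalisation, invisible to every geometric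
statement about the band (k3c3-p1's `frameLevel_of_eval_eq_add_const`). -/
theorem frameLevel_klFlowFrameU_eq_shift (β U μ : ℝ) (n : ℕ) :
    frameLevel μ (klFlowFrameU L M β U μ n) =
      frameLevel (μ + -(∑ m ∈ range n, klAngularMean (klLocalPart L M β U μ (klFlowFrameU L M β U μ m) m)))
        (fsub (klFlowFrameU L M β U μ n) (symInterp L fun _ =>
          -(∑ m ∈ range n, klAngularMean (klLocalPart L M β U μ (klFlowFrameU L M β U μ m) m)))) :=
  frameLevel_of_eval_eq_add_const (eval_klFlowFrameU_eq_oscPart_add β U μ n)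

/-- **The mean-free flow frame is second order**: under `FlowPieceOscAt … c″ … m` at every `m < n`, `|(K_n ⊖ s_n)(q)| ≤ (16/15)·c″·U²` (`0 ≤ c″`). -/
theorem abs_evalM_klFlowFrameU_oscPart_le {c'' β U μ : ℝ} (hc : 0 ≤ c'') {n : ℕ} (h : ∀ m < n, FlowPieceOscAt L M c'' β U μ m) (q : Momentum) :
    |evalM (fsub (klFlowFrameU L M β U μ n) (symInterp L fun _ =>
        -(∑ m ∈ range n, klAngularMean (klLocalPart L M β U μ (klFlowFrameU L M β U μ m) m)))) q| ≤ 16 / 15 * (c'' * U ^ 2) := by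
  rw [evalM_apply, eval_klFlowFrameU_oscPart, abs_neg]
  refine (Finset.abs_sum_le_sum_abs _ _).trans ?_
  calc ∑ m ∈ range n, |(klFlowPiece L M β U μ m).eval (WithLp.ofLp q) - klAngularMean (klLocalPart L M β U μ (klFlowFrameU L M β U μ m) m)|
      ≤ ∑ m ∈ range n, c'' * U ^ 2 * ((16 : ℝ)⁻¹) ^ m := Finset.sum_le_sum fun m hm => by
        have h' := (h m (Finset.mem_range.1 hm)).le_sixteen q
        rw [evalM_apply] at h'
        rwa [inv_pow]
    _ = c'' * U ^ 2 * ∑ m ∈ range n, ((16 : ℝ)⁻¹) ^ m := by rw [Finset.mul_sum]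
    _ ≤ c'' * U ^ 2 * (16 / 15) := by
        have hgeo : ∑ m ∈ range n, ((16 : ℝ)⁻¹) ^ m ≤ 16 / 15 := by
          have h := geom_sum_Ico_le_of_lt_one (m := 0) (n := n) (x := (16 : ℝ)⁻¹) (by norm_num) (by norm_num)
          rw [← Finset.range_eq_Ico] at h
          exact h.trans (by norm_num)
        exact mul_le_mul_of_nonneg_left hgeo (by positivity)
    _ = 16 / 15 * (c'' * U ^ 2) := by ring

/-- **The derivatives of the mean-free flow frame are those of the flow frame** (order `j ≠ 0`): the δμ constant is invisible to every derivative clause. -/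
theorem iteratedFDeriv_evalM_klFlowFrameU_oscPart (β U μ : ℝ) (n : ℕ) {j : ℕ} (hj : j ≠ 0) (q : Momentum) :
    iteratedFDeriv ℝ j (evalM (fsub (klFlowFrameU L M β U μ n) (symInterp L fun _ =>
        -(∑ m ∈ range n, klAngularMean (klLocalPart L M β U μ (klFlowFrameU L M β U μ m) m))))) q =
      iteratedFDeriv ℝ j (evalM (klFlowFrameU L M β U μ n)) q := by
  rw [evalM_fsub_eq]
  simp only [evalM_symInterp_const]
  exact iteratedFDeriv_evalM_sub_const _ _ hj q

end Model

end Summit.HubbardSuperconductivity.HubbardSuperconductivity.Theorems.KLRegimeSplit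

end
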